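/-
COR-CM (cell pub-hodgecm2, stage 2 of the Hodge ladder) — TRANSPOSITION surge, dictionary item (iv) of rfwf v3 §4.2: the TYPED
INTERFACE.  Authored by the typer seat prover-pub-hodgecm2-tr-typer-4-0 (unit pub-hodgecm2-tr-typer-4; RULE (1) pre-ACK
HOME/INBOX l.3654: this seat owns `CorCM/B01/Transposition/Item4*.lean`), 2026-08-21.  Prover behind it: pub-hodgecm2-tr-prover-4
(`CorCM/B01/Transposition/Item4Holds*.lean`).
FRAMING (COORDINATOR RULING 2026-08-21T11:55:35Z): `HC_CM` is NOT proved.  This file asserts nothing: definitions, two `Prop`-valued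
OPEN INPUTS in the binder style of the stage-1 `HodgeCM/StubTree/Inputs.lean`, and small PROVED projections (no `sorry`, no axiom).

TAG (TRANSPOSITION-MAP.md §0-v3, suppliers' net): **PARAMETRIC** — same argument as PerL (weak approximation at the real places for
the signs; Landherr's classification of hermitian planes; PerL's norm-residue product-formula step replaced, as in stage 1, by the
identity `a₃ := a₀a₁a₂⁻¹`), with PerL's index set `Fin 3` (a frame of the sextic `K`; `perlSign`/`IsPerLTypes`, pkg
`HodgeCM/CM/Basic.lean:197/204` = tree `CorCM/CM/Basic.lean:158/165`) replaced by the complex embeddings of `F` and the sign table read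
off `Face.psi` through a sign recipe; «no new estimate» (stage-1 lead, TRANSPOSITION-STAGE1.md); every input of the proof is a TREE
THEOREM (DISCHARGE ROUTE below).  V-AXIS: **V-FREE** (no `HermSpace3` binder occurs), hence V-uniform — see QUANTIFIER AUDIT.
-/
import Summits.HodgeConjecture.CorCM.StubTree.Combinatorics
import Literature.NumberTheory.QuadraticForms.LandherrHermitianPlanesIff
import HarnessLib

/-!
# Transposition item (iv): allowed data — the forced signs of the four hermitian lines and the common seesaw plane
# `W = W₁ ⊕ W₂ ≅ W₃ ⊕ W₄` (PerL Def 3.2, Lemma 3.3 and the paragraph after it) at a general Galois CM field and rank-four face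

MANUSCRIPT LOCATORS.  rfwf v3 §4.2 item (iv) = `run/shared/lean/pub/pub-hodgecm/inputs/2001/summits__hodge-w-rank-four-weil-faces__
free__y1__paper__paper.tex` ll.247–254: «[PerL Def. 3.2, Lemma 3.3] (allowed data; forced signs of the hermitian lines `W_i`;
signatures of `W₁⊕W₂` and `W₃⊕W₄`): uses the infinity types `-Σ_{ρ∈Ψ_i} ρ`, the local sign rules [Y1neg Lemmas 3.1, 3.2], the
unramified Howe correspondence for `(U(1),U(3))`, the identity `m_b(Ψ₁)+m_b(Ψ₂) = m_b(Ψ₃)+m_b(Ψ₄)` at every real place `b` and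
`Ψ₁ ≠ Ψ₂` off `ι₁`.  The choice of the common plane `W = W₁⊕W₂ ≅ W₃⊕W₄`: Landherr's classification …, the product formula for the
norm residue symbol …, and the existence of unitary Hecke characters … (Pontryagin duality argument written for any CM `L/L₀`).
General.»  PerL v5 = `…/literature__sources__internal-hodge-w-pmqp-galois-closure-y1__paper-v5-d912a121.tex`: Def 3.2 `def:allowed`
ll.269–279, Lemma 3.3 `lem:allowed` ll.280–298, the choice of the lines / isometry / splitting characters ll.299–317.

## What item (iv) supplies toward `RealisationExistsFace∃` (= `Universe.FaceThetaDataExists`, `Transposition/Assembly.lean`)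

It is NOT a field of the socket `Universe.FaceThetaDatum` (`CorCM/B01/ThetaRealisationSocket.lean:66–97`); it is the INPUT of the
constructor of the socket's fields `Theta`/`Theta_sub` (item (vi): a theta lift from `U(W_i)` is of type `Ψ_i` exactly when the real
signs of `W_i` are the forced ones — PerL Lemma 3.3(a)) and `coupling` (item (v): the seesaw / isolation argument runs on the COMMON
plane `W` with its two maximal tori `T = U(W₁)×U(W₂)`, `T′ = U(W₃)×U(W₄)`).  In the stage-1 package (root
`run/shared/lean/pub/pub-hodgecm/lean/HodgeCMPerL/`) the same datum is the field `forced` of the good-context guard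
`ThetaModel.GoodCtx` (`HodgeCM/Automorphic/ThetaModel.lean:151`) / model-free `SignRecipe.GoodCtx`
(`HodgeCM/Automorphic/EndStateFieldCensus.lean:90`) = `SInstance.GOG` of the model layer, under which EVERY theta-model input
(`HodgeCM/Automorphic/ThetaFacts.lean:162ff`, `Open_thetaSub` …) and every `HodgeCM/Model/**` theorem is stated (TRANSPOSITION-MAP.md
§3, sinst-1 block: «the face enters ONLY through `c.K / c.Ψ / c.σ / c.D` and the one guard `GOG`»).  This file types, over the
TREE's `CMField` / `Face` / `Face.psi` / `Face.Admissible` / `PairSum` (`CorCM/CM/Basic.lean:67/92/123/133/147`, imported, not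
re-declared):

* `SignRecipe F` — PerL's sign recipe `(κ, s)` abstracted exactly as the stage-1 theta model carries it (`ThetaModel.kappa` /
  `ThetaModel.frameSign`, `ThetaModel.lean:92/95`, with its two DESIGN constraints `Design_kappaConj` / `Design_frameSignConj`,
  `ThetaFacts.lean:135/144`, as fields) at the face setting `K = L = F`, `j = id`; `SignRecipe.reqPos` — the REQUIRED sign of the
  line of type `Ψ` at `τ` (Lemma 3.3(a); = `ThetaModel.reqPos` `:138`, `SignRecipe.reqPos` `EndStateFieldCensus.lean:79`);
  `SignRecipe.basic` — a recipe exists (NON-VACUITY witness of the `∀ R` binder; not the recipe of record).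
* `SeesawDatum F` — Def 3.2's four lines `W_i = (F, a_i x ȳ)`, `a_i ∈ F₀^×`, with `W₁ ⊕ W₂ ≅ W₃ ⊕ W₄` (= `StubTree.SeesawDatum`,
  `HodgeCM/StubTree/PerLProof.lean:60`, verbatim in the tree's Landherr spelling `IsCMField.complexConj`).
* `SignsForced R Ψ D` (= `ThetaModel.SignsForced` `:143` / `EndStateFieldCensus.lean:83`) and the bundle `FaceSignDatum R Ψ`
  (lines + isometry + forced signs) — the «FaceSignDatum» of the stage-2 lead's §3 block.
* `GoodFaceCtx R Ψ σ D` — the guard (= `SignRecipe.GoodCtx` at `K = L = F`, `j = id`), and its constructor at a face from a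
  `FaceSignDatum` (`pairSum_psi` `CorCM/CM/Lemmas.lean:72`, `StubTree.psi_injective` `CorCM/StubTree/Combinatorics.lean:37`,
  `admissible_mem_psi` `CorCM/CM/Lemmas.lean:91` — items (T1)(T2) of the audit, tree theorems).
* THE TYPED AXIOM `FaceSignDatumExists` — binder prefix of `RealisationExistsFace` (pkg `HodgeCM/StubTree/Inputs.lean:97–100`) with
  `∀ V` DROPPED (not weakened to `∃ V`: the item does not mention `V`) and `∀ R : SignRecipe F` added; and the general form
  `SeesawDatumExists` that PerL's proof literally gives (any quadruple with the pair-sum identity, any CM field), with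
  `faceSignDatumExists_of_seesawDatumExists`.
* PROVED projections the consumers use: the sign read-out (`FaceSignDatum.pos_iff`); PerL Lemma 3.3(b) — the two planes have the
  same signature at every place (`SeesawDatum.signs_pair_eq`) — and equal discriminants (`SeesawDatum.disc_eq`), both read off the
  isometry by the tree's `hermitianPlanes_invariants_of_isometric` (`Literature/NumberTheory/QuadraticForms/
  LandherrHermitianPlanesIff.lean:189`); `reqPos` is a function of the PLACE (`SignRecipe.reqPos_conjugate`, port of
  `HodgeCM/Proofs/RealisationConstruction.lean:86`); the `ε_hol` clause of Lemma 3.3(a) (`GoodFaceCtx.pos_iff_frameSign`); and what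
  the next items receive per face (`exists_goodFaceCtx_of_faceSignDatumExists`).

## QUANTIFIER AUDIT (RE-POINT (1))
`FaceSignDatumExists = ∀ F (IsGalois ℚ F, 6 ≤ [F:ℚ]) ∀ f : Face F ∀ ι₁ (f.Admissible ι₁) ∀ R : SignRecipe F, Nonempty (FaceSignDatum R f.psi)`.
NO `V`, NO level.  The plane `W` is the `U(W)`-side of the dual pair `(U(W), U(V₃)) ⊂ Sp(V₃ ⊗ W)` (PerL §3.2 ll.258–268), not a
subspace of `V₃`; the local sign rules ([Y1neg] Lemmas 3.1/3.2) read `V₃` only through its signatures, which `HermSpace3` FIXES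
(`(2,1)` at `ι₁`, `(3,0)` elsewhere; `CorCM/CM/Basic.lean:182–191`).  The early cut's «∃ form: ∃ W ⊂ V» (TRANSPOSITION-MAP.md §0 row
(iv)) is therefore realised as `∃ D : SeesawDatum F` with NO `V` binder — stronger than any ∃V/∀V form and exactly what PerL delivers:
the stage-1 construction `ThetaModel.exists_seesawDatum` (`HodgeCM/Proofs/RealisationConstruction.lean:183`) has no `V` and arbitrary
`(K, L, j, ι₁, Ψ)` with `PairSum Ψ`.  `∀ ι₁`, `∀ R` are universals PerL proves; the assembly instantiates them at its chosen `ι₁`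
and at the recipe its Weil model carries (stage 1: `SignRecipe.kappa (orientBitι L ι₁)`, `SignRecipe.frameSign`,
`HodgeCM/Automorphic/SignRecipe.lean:306/218`, `HodgeCM/Model/ArchKTypeOfOrient.lean:346`).

## Stage-1 declarations this item generalises (pkg root `run/shared/lean/pub/pub-hodgecm/lean/HodgeCMPerL/`)
`HodgeCM/CM/Basic.lean:197 perlSign`, `:204 IsPerLTypes` (PerL's fixed sign table on a 3-place frame — here `SignRecipe.reqPos R (f.psi i)`
on all embeddings of `F`); `HodgeCM/StubTree/PerLProof.lean:60 StubTree.SeesawDatum` (verbatim); `HodgeCM/Automorphic/ThetaModel.lean:92/95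
kappa/frameSign`, `:138 reqPos`, `:143 SignsForced`, `:151 GoodCtx`; `HodgeCM/Automorphic/EndStateFieldCensus.lean:79/83/90` (the
model-free twins); `HodgeCM/Automorphic/ThetaFacts.lean:135/144 Design_kappaConj/Design_frameSignConj`;
`HodgeCM/Proofs/RealisationConstruction.lean:86 reqPos_conjugate`, `:96 reqPos_pairSum`, `:122 exists_signsForced`, `:183 exists_seesawDatum`
(the PROOFS tr-prover-4 ports; their face instantiation is `:355 realisationExistsFace_of`); `HodgeCM/StubTree/Inputs.lean:54
Lemma33bLandherr` (pkg-proved `lemma33bLandherr_holds`, `HodgeCM/Literature/NormTheoremHolds.lean:218`; TREE twin: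
`Literature.NumberTheory.QuadraticForms.hermitianPlanes_isometric_of_invariants`, `LandherrHermitianPlanes.lean:325`).

## DISCHARGE ROUTE for `pub-hodgecm2-tr-prover-4` (target `CorCM/B01/Transposition/Item4Holds.lean`; all inputs are tree theorems)
`theorem seesawDatumExists_holds : SeesawDatumExists` — (1) `SignRecipe.reqPos_conjugate` (here) makes the required sign of line `i` a
function `P i : InfinitePlace F → Bool`; (2) `Literature.NumberTheory.NumberFields.exists_isReal_signs`
(`Literature/NumberTheory/NumberFields/CMFieldPrescribedSigns.lean:128`) gives `a₀, a₁, a₂ ∈ F⁺`, real non-zero at every `τ`, with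
those signs; (3) `a₃ := a₀a₁a₂⁻¹` carries the required sign by the parity half of Lemma 3.3(b) (port `reqPos_pairSum`, pkg `:96`, an
8-case split on the pair-sum identity at `κ τ`) and makes `a₀a₁ = a₂a₃ · N(1)`; (4) the isometry is
`Literature.NumberTheory.QuadraticForms.hermitianPlanes_isometric_of_invariants` (`LandherrHermitianPlanes.lean:325`) — its two
hypotheses are exactly (3)'s sign multisets and discriminant.  Then `faceSignDatumExists_holds := faceSignDatumExists_of_seesawDatumExists _`.
Expected size ≈ 120 lines (pkg `exists_signsForced` + `exists_seesawDatum` are 75 lines).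

## Deliberately NOT in this file
* The SPLITTING CHARACTERS `μ_i`, `μ_W` (unitary Hecke characters of `F` with components `(z/|z|)^{m_b}` and restriction `ε^m` to
  `𝔸^×_{F₀}`; PerL ll.305–314 «Pontryagin duality», rfwf ll.252–254): the stage-1 abstract layer does not type them at Def 3.2 either
  («TYPING NOTE» of `StubTree.SeesawDatum`: they live behind `Perl34.TorusData.allowed/X`); in the model layer they are CONSTRUCTED
  over an arbitrary `L : CMField` (`HodgeCM/Model/ArchSideOf.lean:160–171 eta₀…eta₃`; sinst-1 / theta-3 blocks: VERBATIM) and are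
  consumed by items (v)/(vi) (`Open_chars`, the torus data), whose typers own them.
* The VALUES of the recipe (`κ(ι₁∘g) = ι₁∘g⁻¹∘φ^h`, `frameSign` = the `η_L`-representative system; `SignRecipe.lean:306/218`) and the
  Weil-model normalisation (N1)/(N2) under which `SignsForced` IS PerL's forced sign — a convention of the CONSUMER's Weil model
  (`HodgeCM/Automorphic/SignRecipe.lean` header: «Def 3.2 / Lemma 3.3 consume only "the forced signs" as a function of the PLACE …
  the construction of the seesaw datum with those signs works for every such function»); b01-idea-2's INVERSE-TYPE RULE
  (TRANSPOSITION-MAP.md §0-v2) is a statement about `κ`, i.e. about that instantiation, not about this item.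
* Anything about `V`, levels or theta forms (items (iii)(v)(vi)); the pair-sum identity and distinctness themselves (item (ii) —
  tree theorems, imported here).
-/

noncomputable section

open NumberField NumberField.ComplexEmbedding
open scoped Matrix

namespace Summit.HodgeConjecture.CorCM

namespace Transposition

open Literature.AlgebraicGeometry.Motives (CMType)
open Literature.NumberTheory.ComplexMultiplication.CMTypeOps

/-! ### 1. The sign recipe and the required signs (PerL Lemma 3.3(a)) -/

/-- **PerL's sign recipe at the face setting `K = L = F`** (PerL v5 §1.1 ll.48–54, (eq:Psit) ll.61–65, Lemma 3.3(a) ll.280–284;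
stage-1 `HodgeCM.Universe.ThetaModel.kappa/frameSign`, `HodgeCM/Automorphic/ThetaModel.lean:92/95`, with the two DESIGN constraints
`ThetaModel.Design_kappaConj/Design_frameSignConj`, `HodgeCM/Automorphic/ThetaFacts.lean:135/144`, carried as fields): `κ(τ)` is the
embedding of `F` whose membership in a type `Ψ` decides whether the line of type `Ψ` carries the frame sign or its opposite at the
complex embedding `τ`; `s(τ)` is the frame sign attached to ONE of the two embeddings over each place ([Y1neg] v2 Lemmas 3.1/3.2: the
representatives `ρ_b`, `ε_hol` at `ι₁`).  The VALUES are the consumer's (stage 1: `SignRecipe.kappa (orientBitι L ι₁)`,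
`SignRecipe.frameSign`); this item is uniform in them. [folklore] -/
structure SignRecipe (F : CMField) where
  /-- `κ(τ) : F →+* ℂ` — whose membership in `Ψ` decides the sign of the line of type `Ψ` at `τ` -/
  kappa : (F →+* ℂ) → (F →+* ℂ)
  /-- `s(τ)` — the frame sign, `true` at exactly one of the two embeddings over each place -/
  frameSign : (F →+* ℂ) → Bool
  /-- `κ(τ̄) = conj ∘ κ(τ)` (stage-1 `Design_kappaConj`: centrality of complex conjugation) -/
  kappa_conjugate : ∀ τ : F →+* ℂ, kappa (conjugate τ) = conjugate (kappa τ)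
  /-- `s(τ̄) = ¬ s(τ)` (stage-1 `Design_frameSignConj`) -/
  frameSign_conjugate : ∀ τ : F →+* ℂ, frameSign (conjugate τ) = !(frameSign τ)

namespace SignRecipe

variable {F : CMField} (R : SignRecipe F)

/-- **The required sign** (`true` = positive) of the hermitian line of type `Ψ` at the complex embedding `τ` of `F` (PerL Lemma 3.3(a),
tex ll.280–284: `s_b(W_i) = m⁻¹(m_b(Ψ_i))` for `b ≠ ι₁`, `s_{ι₁}(W_i) = ε_hol`): the frame sign at `τ` if `κ(τ) ∈ Ψ`, its negation
otherwise.  VERBATIM the stage-1 `ThetaModel.reqPos` (`HodgeCM/Automorphic/ThetaModel.lean:138`) at `K = L = F`, `j = id`. [folklore] -/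
def reqPos (Ψ : CMType F) (τ : F →+* ℂ) : Bool :=
  if ind Ψ (R.kappa τ) = 1 then R.frameSign τ else !(R.frameSign τ)

/-- `reqPos` when `κ(τ) ∈ Ψ`: the frame sign. [folklore] -/
theorem reqPos_eq_frameSign_of_mem {Ψ : CMType F} {τ : F →+* ℂ} (h : R.kappa τ ∈ Ψ.1) : R.reqPos Ψ τ = R.frameSign τ := by
  unfold reqPos
  rw [if_pos (ind_of_mem h)]

/-- `reqPos` when `κ(τ) ∉ Ψ`: the opposite of the frame sign. [folklore] -/
theorem reqPos_eq_not_frameSign_of_not_mem {Ψ : CMType F} {τ : F →+* ℂ} (h : R.kappa τ ∉ Ψ.1) :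
    R.reqPos Ψ τ = !(R.frameSign τ) := by
  unfold reqPos
  rw [ind_of_not_mem h, if_neg]
  exact zero_ne_one

/-- **The required sign is a function of the PLACE**: `reqPos Ψ τ̄ = reqPos Ψ τ` (port of the stage-1
`ThetaModel.reqPos_conjugate`, `HodgeCM/Proofs/RealisationConstruction.lean:86`: the CM-type axiom `κ(τ) ∈ Ψ ↔ conj κ(τ) ∉ Ψ` and the two
design constraints cancel).  This is what lets weak approximation at the real places (`NumberFields.exists_isReal_signs`) produce lines
with the required signs. [folklore] -/
theorem reqPos_conjugate (Ψ : CMType F) (τ : F →+* ℂ) : R.reqPos Ψ (conjugate τ) = R.reqPos Ψ τ := by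
  by_cases h : R.kappa τ ∈ Ψ.1
  · have h' : R.kappa (conjugate τ) ∉ Ψ.1 := by
      rw [R.kappa_conjugate]
      exact (mem_iff_conjugate_notMem Ψ _).mp h
    rw [R.reqPos_eq_frameSign_of_mem h, R.reqPos_eq_not_frameSign_of_not_mem h', R.frameSign_conjugate, Bool.not_not]
  · have h' : R.kappa (conjugate τ) ∈ Ψ.1 := by
      rw [R.kappa_conjugate]
      exact (conjugate_mem_iff_notMem Ψ _).mpr h
    rw [R.reqPos_eq_not_frameSign_of_not_mem h, R.reqPos_eq_frameSign_of_mem h', R.frameSign_conjugate]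

/-- **The `ε_hol` clause of Lemma 3.3(a)** (tex l.284: `s_{ι₁}(W_i) = ε_hol` for all `i`): at an embedding `τ` whose `κ(τ)` lies in all
four types (at `τ = ι₁` for an admissible `ι₁` and a recipe with `κ(ι₁) = ι₁`, by `admissible_mem_psi`) the four required signs
coincide (with the frame sign). [folklore] -/
theorem reqPos_eq_of_forall_mem (Ψ : Fin 4 → CMType F) {τ : F →+* ℂ} (h : ∀ i, R.kappa τ ∈ (Ψ i).1) (i j : Fin 4) :
    R.reqPos (Ψ i) τ = R.reqPos (Ψ j) τ := by
  rw [R.reqPos_eq_frameSign_of_mem (h i), R.reqPos_eq_frameSign_of_mem (h j)]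

/-- **A sign recipe exists** (NON-VACUITY witness for the binder `∀ R : SignRecipe F`; NOT the recipe of record): `κ := id` and the frame
sign `s(τ) := (0 < Im τ(θ))` for a non-zero `θ ∈ F` with `θ̄ = -θ` (cf. the stage-1 `η_L`-representatives, `SignRecipe.frameSign`,
`HodgeCM/Automorphic/SignRecipe.lean:218`; a skew `θ` exists: `Landherr.exists_skew`). [folklore] -/
def basic (θ : F) (hθ : IsCMField.complexConj F θ = -θ) (hθ0 : θ ≠ 0) : SignRecipe F where
  kappa := id
  frameSign τ := decide (0 < (τ θ).im)
  kappa_conjugate _ := rfl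
  frameSign_conjugate τ := by
    have him : (conjugate τ θ).im = -(τ θ).im := by
      rw [conjugate_coe_eq, Complex.conj_im]
    have hre : (τ θ).re = 0 := by
      have h := IsCMField.complexEmbedding_complexConj F τ θ
      rw [hθ, map_neg] at h
      have h2 := congrArg Complex.re h
      rw [Complex.neg_re, Complex.conj_re] at h2
      linarith
    have hne : (τ θ).im ≠ 0 := by
      intro h0
      apply hθ0
      have : τ θ = 0 := Complex.ext (by rw [hre, Complex.zero_re]) (by rw [h0, Complex.zero_im])
      exact (map_eq_zero τ).mp this
    rw [him]
    rcases hne.lt_or_gt with hlt | hgt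
    · rw [decide_eq_true (neg_pos.mpr hlt), decide_eq_false (not_lt.mpr hlt.le)]; rfl
    · rw [decide_eq_false (not_lt.mpr (neg_nonpos.mpr hgt.le)), decide_eq_true hgt]; rfl

/-- `SignRecipe F` is inhabited for every CM field `F` (so the `∀ R` binder of `FaceSignDatumExists` is not vacuous). [folklore] -/
instance instNonempty (F : CMField) : Nonempty (SignRecipe F) := by
  obtain ⟨θ, hθ0, hθ⟩ := Literature.NumberTheory.QuadraticForms.Landherr.exists_skew (F : Type)
  exact ⟨basic θ hθ hθ0⟩

end SignRecipe

/-! ### 2. Def 3.2: the four lines and the common plane `W₁ ⊕ W₂ ≅ W₃ ⊕ W₄` -/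

/-- **PerL Def 3.2 (data)** (tex ll.269–279, 299–304): four hermitian LINES `W_i = (F, a_i x ȳ)` over `F` relative to `F/F₀`
(`a_i ∈ F₀^×`: `ā_i = a_i`, `a_i ≠ 0`) and an isometry of hermitian planes `W₁ ⊕ W₂ ≅ W₃ ⊕ W₄ =: W` (the common seesaw plane),
rendered as a `GL₂(F)`-congruence of the diagonal Gram matrices.  VERBATIM the stage-1 `HodgeCM.StubTree.SeesawDatum`
(`HodgeCM/StubTree/PerLProof.lean:60`), in the spelling of the tree's Landherr files (`IsCMField.complexConj F`, definitionally the
package's `conjRingHomK` / the tree's `cmConjRingHom`, `CorCM/CM/Basic.lean:207–211`), so that `iso` is literally the conclusion of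
`Literature.NumberTheory.QuadraticForms.hermitianPlanes_isometric_of_invariants`.  As there: the embeddings of the dual pairs
`(U(W_i), U(V₃))` and the splitting characters are not part of this datum. [folklore] -/
structure SeesawDatum (F : CMField) where
  /-- the four line coefficients `a_i ∈ F₀^×` -/
  a : Fin 4 → F
  /-- `a_i ∈ F₀`: fixed by complex conjugation -/
  a_real : ∀ i, IsCMField.complexConj F (a i) = a i
  /-- `a_i ≠ 0` (non-degenerate lines) -/
  a_ne : ∀ i, a i ≠ 0
  /-- `W₁ ⊕ W₂ ≅ W₃ ⊕ W₄`: `ᵗḡ · diag(a₀, a₁) · g = diag(a₂, a₃)` for some `g ∈ GL₂(F)` -/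
  iso : ∃ g : GL (Fin 2) F,
    ((g : Matrix (Fin 2) (Fin 2) F).transpose.map (IsCMField.complexConj F)) * Matrix.diagonal ![a 0, a 1] *
      (g : Matrix (Fin 2) (Fin 2) F) = Matrix.diagonal ![a 2, a 3]

namespace SeesawDatum

variable {F : CMField} (D : SeesawDatum F)

/-- **PerL Lemma 3.3(b)** (tex ll.284–286: `W₁ ⊕ W₂` and `W₃ ⊕ W₄` have the same signature at every real place — `(2,0)`/`(0,2)` at
`ι₁`, definite on `D₁₂`, `(1,1)` on `Σ₁₂`), in multiset form at every complex embedding, READ OFF THE ISOMETRY by the necessity half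
of Landherr's theorem (tree `hermitianPlanes_invariants_of_isometric`, `LandherrHermitianPlanesIff.lean:189`; Sylvester).
[cite: Landherr1936HermitianForms] -/
theorem signs_pair_eq (τ : F →+* ℂ) :
    ({decide (0 < (τ (D.a 0)).re), decide (0 < (τ (D.a 1)).re)} : Multiset Bool) =
      {decide (0 < (τ (D.a 2)).re), decide (0 < (τ (D.a 3)).re)} :=
  (Literature.NumberTheory.QuadraticForms.hermitianPlanes_invariants_of_isometric F D.a D.a_real D.a_ne D.iso).1 τ

/-- The two planes have the same discriminant in `F₀^× / N(F^×)`: `a₀a₁ = a₂a₃ · N(z)` (read off the isometry; PerL tex ll.299–304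
arranges this by the norm-residue product formula, the stage-1 construction by `a₃ := a₀a₁a₂⁻¹`). [cite: Landherr1936HermitianForms] -/
theorem disc_eq : ∃ z : F, z ≠ 0 ∧ D.a 0 * D.a 1 = D.a 2 * D.a 3 * (z * IsCMField.complexConj F z) :=
  (Literature.NumberTheory.QuadraticForms.hermitianPlanes_invariants_of_isometric F D.a D.a_real D.a_ne D.iso).2

/-- Each `a_i` is real at every complex embedding (`a_i ∈ F₀`). [folklore] -/
theorem embedding_eq_re (i : Fin 4) (τ : F →+* ℂ) : τ (D.a i) = ((τ (D.a i)).re : ℂ) :=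
  Literature.NumberTheory.QuadraticForms.Landherr.embedding_eq_re (D.a_real i) τ

end SeesawDatum

/-- **PerL Def 3.2 "with the forced signs"** (tex ll.299–304): the four lines of `D` carry, at every complex embedding, the signs the
recipe `R` requires for the types `Ψ_i`.  VERBATIM the stage-1 `ThetaModel.SignsForced` (`HodgeCM/Automorphic/ThetaModel.lean:143`) /
`SignRecipe.SignsForced` (`EndStateFieldCensus.lean:83`) at `K = L = F`, `j = id`. [folklore] -/
def SignsForced {F : CMField} (R : SignRecipe F) (Ψ : Fin 4 → CMType F) (D : SeesawDatum F) : Prop :=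
  ∀ (i : Fin 4) (τ : F →+* ℂ), (0 < (τ (D.a i)).re ↔ R.reqPos (Ψ i) τ = true)

/-- **The sign/plane datum of item (iv)** for a recipe `R` and four types `Ψ` (the stage-2 lead's «FaceSignDatum», TRANSPOSITION-MAP.md
§3): Def 3.2's four lines WITH the forced signs AND the common plane `W₁ ⊕ W₂ ≅ W₃ ⊕ W₄`.  Data, asserted by no one. [folklore] -/
structure FaceSignDatum {F : CMField} (R : SignRecipe F) (Ψ : Fin 4 → CMType F) extends SeesawDatum F where
  /-- the forced signs: `0 < τ(a_i) ↔ reqPos R Ψ_i τ` -/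
  forced : ∀ (i : Fin 4) (τ : F →+* ℂ), (0 < (τ (a i)).re ↔ R.reqPos (Ψ i) τ = true)

namespace FaceSignDatum

variable {F : CMField} {R : SignRecipe F} {Ψ : Fin 4 → CMType F}

/-- The forced signs as the named predicate on the underlying seesaw datum. [folklore] -/
theorem signsForced (D : FaceSignDatum R Ψ) : SignsForced R Ψ D.toSeesawDatum := D.forced

/-- Sign read-out of line `i` at `τ`. [folklore] -/
theorem pos_iff (D : FaceSignDatum R Ψ) (i : Fin 4) (τ : F →+* ℂ) :
    0 < (τ (D.a i)).re ↔ R.reqPos (Ψ i) τ = true := D.forced i τ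

/-- `decide` form of the sign read-out. [folklore] -/
theorem decide_pos_eq (D : FaceSignDatum R Ψ) (i : Fin 4) (τ : F →+* ℂ) :
    decide (0 < (τ (D.a i)).re) = R.reqPos (Ψ i) τ := by
  have h := D.pos_iff i τ
  cases hb : R.reqPos (Ψ i) τ
  · rw [hb] at h
    exact decide_eq_false fun hp => Bool.false_ne_true (h.mp hp)
  · rw [hb] at h
    exact decide_eq_true (h.mpr rfl)

/-- **Lemma 3.3(b) for the REQUIRED signs**: if a sign/plane datum exists for `(R, Ψ)` then at every embedding the multisets of required
signs `{s(W₁), s(W₂)}` and `{s(W₃), s(W₄)}` agree — the necessary condition that the pair-sum identity of `Ψ` guarantees (stage-1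
`reqPos_pairSum`, `RealisationConstruction.lean:96`). [folklore] -/
theorem reqPos_pair_eq (D : FaceSignDatum R Ψ) (τ : F →+* ℂ) :
    ({R.reqPos (Ψ 0) τ, R.reqPos (Ψ 1) τ} : Multiset Bool) = {R.reqPos (Ψ 2) τ, R.reqPos (Ψ 3) τ} := by
  have h := D.toSeesawDatum.signs_pair_eq τ
  rw [D.decide_pos_eq 0 τ, D.decide_pos_eq 1 τ, D.decide_pos_eq 2 τ, D.decide_pos_eq 3 τ] at h
  exact h

end FaceSignDatum

/-! ### 3. The good-context guard at a face (stage-1 `GoodCtx` at `K = L = F`) -/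

/-- **PerL's hypotheses on a seesaw context, face setting** — VERBATIM the stage-1 model-free guard `HodgeCM.SignRecipe.GoodCtx`
(`HodgeCM/Automorphic/EndStateFieldCensus.lean:90`; = `ThetaModel.GoodCtx`, `ThetaModel.lean:151`; = the model layer's `SInstance.GOG`)
at `K = L = F`, `j = id` (so its `∃ j, ι₁ ∘ j = σ ∧ …` collapses): the four types satisfy the pair-sum identity and are pairwise distinct,
the eigen-embedding `σ` lies in all four, and the lines of `D` carry the forced signs.  Every stage-1 theta-model input
(`ThetaFacts.lean:162ff`) and `HodgeCM/Model/**` theorem is stated under this guard; items (v)/(vi) re-instantiate them at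
`(F, f.psi, ι₁, D)`. [folklore] -/
structure GoodFaceCtx {F : CMField} (R : SignRecipe F) (Ψ : Fin 4 → CMType F) (σ : F →+* ℂ) (D : SeesawDatum F) : Prop where
  /-- `1_{Ψ₁} + 1_{Ψ₂} = 1_{Ψ₃} + 1_{Ψ₄}` (transposition input (T1)) -/
  pairSum : PairSum Ψ
  /-- the four types are pairwise distinct (transposition input (T2)) -/
  injective : Function.Injective Ψ
  /-- `σ ∈ Ψ_i` for all `i` -/
  mem : ∀ i, σ ∈ (Ψ i).1
  /-- the lines carry the forced signs -/
  forced : SignsForced R Ψ D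

/-- **Constructor at a face**: a sign/plane datum for `(R, f.psi)` and an admissible `ι₁` give a good face context — the other three
clauses are the TREE theorems `pairSum_psi` (`CorCM/CM/Lemmas.lean:72`), `StubTree.psi_injective` (`CorCM/StubTree/Combinatorics.lean:37`),
`admissible_mem_psi` (`CorCM/CM/Lemmas.lean:91`) (cf. stage-1 `realisationExistsFace_of`, `RealisationConstruction.lean:355`). [folklore] -/
theorem goodFaceCtx_of_faceSignDatum {F : CMField} (R : SignRecipe F) (f : Face F) (ι₁ : F →+* ℂ) (hι : f.Admissible ι₁)
    (D : FaceSignDatum R f.psi) : GoodFaceCtx R f.psi ι₁ D.toSeesawDatum :=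
  ⟨pairSum_psi f, StubTree.psi_injective F f, admissible_mem_psi f ι₁ hι, D.signsForced⟩

namespace GoodFaceCtx

variable {F : CMField} {R : SignRecipe F} {Ψ : Fin 4 → CMType F} {σ : F →+* ℂ} {D : SeesawDatum F}

/-- **The `ε_hol` clause of Lemma 3.3(a) under the guard**: at an embedding `τ` with `κ(τ) = σ` (PerL: `τ = ι₁`, `κ(ι₁) = φ₁ = σ` for
the recipe bit `h = false`) all four lines have the sign `s(τ)`. [folklore] -/
theorem pos_iff_frameSign (h : GoodFaceCtx R Ψ σ D) {τ : F →+* ℂ} (hκ : R.kappa τ = σ) (i : Fin 4) :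
    0 < (τ (D.a i)).re ↔ R.frameSign τ = true := by
  rw [h.forced i τ, R.reqPos_eq_frameSign_of_mem (by rw [hκ]; exact h.mem i)]

/-- Under the guard the two planes have equal sign multisets at every embedding (from the isometry alone). [folklore] -/
theorem signs_pair_eq (_h : GoodFaceCtx R Ψ σ D) (τ : F →+* ℂ) :
    ({decide (0 < (τ (D.a 0)).re), decide (0 < (τ (D.a 1)).re)} : Multiset Bool) =
      {decide (0 < (τ (D.a 2)).re), decide (0 < (τ (D.a 3)).re)} :=
  D.signs_pair_eq τ

end GoodFaceCtx

/-! ### 4. The typed axiom of item (iv) and its general form -/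

/-- **Item (iv), general form — what PerL's proof of Def 3.2 / Lemma 3.3 literally gives** (tex ll.299–304; stage-1
`ThetaModel.exists_seesawDatum`, `HodgeCM/Proofs/RealisationConstruction.lean:183`, PROVED there for every CM field and every
conjugation-compatible recipe): for every CM field `F`, every quadruple of CM types with the pair-sum identity and every sign recipe,
four lines with the forced signs and `W₁ ⊕ W₂ ≅ W₃ ⊕ W₄` exist.  OPEN INPUT of the transposition (binder style; asserted by no one;
tr-prover-4 discharges it from tree theorems — module docstring, DISCHARGE ROUTE). [folklore] -/
@[conjecture]
def SeesawDatumExists : Prop :=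
  ∀ (F : CMField) (Ψ : Fin 4 → CMType F), PairSum Ψ → ∀ R : SignRecipe F, Nonempty (FaceSignDatum R Ψ)

/-- **Item (iv) of rfwf v3 §4.2 — THE TYPED AXIOM** (tex ll.247–254; PerL Def 3.2 / Lemma 3.3 ll.269–304): for every Galois CM field `F`
with `6 ≤ [F:ℚ]`, every rank-four face `f`, every admissible `ι₁` and every sign recipe, a sign/plane datum for the period types `f.psi`
exists — Def 3.2's four lines with the forced signs and the common plane `W = W₁ ⊕ W₂ ≅ W₃ ⊕ W₄`.  Binder prefix of the stage-1
`Universe.RealisationExistsFace` (`HodgeCM/StubTree/Inputs.lean:97–100`) with `∀ V` DROPPED (the item is `V`-free: `W` is the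
`U(W)`-side of the dual pair `(U(W), U(V₃))`, and `V₃` enters the sign rules only through its signatures, fixed by `HermSpace3`).
OPEN INPUT (binder style; asserted by no one); follows from `SeesawDatumExists` by `pairSum_psi`. [folklore] -/
@[conjecture]
def FaceSignDatumExists : Prop :=
  ∀ (F : CMField), IsGalois ℚ F → 6 ≤ Module.finrank ℚ F →
    ∀ (f : Face F) (ι₁ : F →+* ℂ), f.Admissible ι₁ →
    ∀ R : SignRecipe F, Nonempty (FaceSignDatum R f.psi)

/-- The general form gives the face form (`pairSum_psi`, `CorCM/CM/Lemmas.lean:72`; the Galois / degree / admissibility binders are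
idle for this item). [folklore] -/
theorem faceSignDatumExists_of_seesawDatumExists (h : SeesawDatumExists) : FaceSignDatumExists :=
  fun F _ _ f _ _ R => h F f.psi (pairSum_psi f) R

/-- **What the next items receive per face**: under `FaceSignDatumExists`, every face context `(F, f, ι₁)` and recipe `R` admit a
seesaw datum `D` with `GoodFaceCtx R f.psi ι₁ D` — the guard at which items (v)/(vi) re-instantiate the stage-1 theta-model inputs
and model theorems by name. [folklore] -/
theorem exists_goodFaceCtx_of_faceSignDatumExists (h : FaceSignDatumExists) (F : CMField) (hG : IsGalois ℚ F)
    (h6 : 6 ≤ Module.finrank ℚ F) (f : Face F) (ι₁ : F →+* ℂ) (hι : f.Admissible ι₁) (R : SignRecipe F) :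
    ∃ D : SeesawDatum F, GoodFaceCtx R f.psi ι₁ D := by
  obtain ⟨D⟩ := h F hG h6 f ι₁ hι R
  exact ⟨D.toSeesawDatum, goodFaceCtx_of_faceSignDatum R f ι₁ hι D⟩

end Transposition

end Summit.HodgeConjecture.CorCM

end
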